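import Summits.HodgeConjecture.HodgeConjecture.Theorems.LimitExtensionMiddleDivisorSupportSuffices
import Literature.AlgebraicGeometry.HodgeTheory.GysinKernelSplit
import Literature.AlgebraicGeometry.HodgeTheory.HodgeRiemannPolarizabilityProofs
import Literature.AlgebraicGeometry.HodgeTheory.BirationalMorphismDegree
import Literature.AlgebraicGeometry.HodgeTheory.HodgeTypeExteriorProduct
import Literature.AlgebraicGeometry.HodgeTheory.GysinFormalismCorrespondences
import Literature.AlgebraicGeometry.HodgeTheory.DivisorInduction

/-!
# Route LimitExtension · `MiddleDivisorSupportSuffices` (stmt-HodgeConjecture-10865):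
# the divisor step through a modification — Prop. 8.2.7 is needed only for the exceptional family

The item `MiddleDivisorSupportSuffices` (Thomas 2005, Prop. 2 / de Cataldo–Migliorini 2009 §4
Prop. 4.5) is proved in the tree modulo two leaves (`middleDivisorSupportSuffices_of_twoLeaves`,
`Theorems/LimitExtensionMiddleDivisorSupportSufficesTwoLeaves`): Deligne, *Hodge III*, Prop. 8.2.7
in Čech form for an ARBITRARY finite family of morphisms from smooth projective varieties
(`Deligne1974_ker_pullback_eq_ker_pullback_resolution`, unproved: mixed Hodge theory of a singular
`Z`) and the pencil crux `PencilReduction` (stmt-HodgeConjecture-1083). The first leaf enters only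
through the divisor step (`DivisorInduction`, stmt-HodgeConjecture-1082: a rational `(p,p)`-class of
an `(n+1)`-fold dying off a closed `Z` of codimension `≥ 1` is algebraic, granted the Hodge
conjecture in codimension `p − 1` on `n`-folds), where it is applied to resolutions of the
components of `Z` — an arbitrary, singular configuration.

This file records that the divisor step, and with it the item, needs Prop. 8.2.7 only for the
EXCEPTIONAL FAMILY OF A MODIFICATION: if `π : X' ⟶ X` is a birational morphism of smooth projective
`(n+1)`-folds and `e i : E i ⟶ X'` a finite family of morphisms from smooth projective `n`-folds whose
images cover `π⁻¹(Z)` and for which Prop. 8.2.7 holds in Čech form ON `X'` (the per-family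
hypothesis `H` of the tree's `ker_restrictCompl_eq_iSup_range_complexGysin_of_pullback`), then the
class descends: `π^* c` dies off `⋃ i, e_i(E i)` (restriction commutes with pull-back), is rational of
type `(p,p)` (pull-backs preserve both: `IsRationalClass.map`,
`IsOfHodgeType.map_of_isSmoothProjective`), hence is a sum of Gysin images `(e i)_* b_i` of rational
`(p-1,p-1)`-classes (Cor. 8.2.8 for THIS family from `H`, and Voisin's lift
`Voisin2025_hodgeClass_lift_complexGysin_holds`, a theorem), hence algebraic by the Hodge conjecture
on the `n`-folds `E i` and `complexGysin_mem_algebraicClasses`; and algebraicity descends along the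
degree-one map `π` (`exists_hasDegree_one_of_isBirational`,
`mem_algebraicClasses_of_map_mem_of_hasDegree`: `π_!π^* c = c`). The intended supplier of such data
is the tree's PROVED log resolution into a simple-normal-crossings divisor
(`Literature.AlgebraicGeometry.Resolution.exists_logResolution_of_isClosed`, Kollár Thm. 3.21) together with Prop. 8.2.7 for the
smooth components of an SNC divisor — the "principle of two types" (Deligne–Griffiths–Morgan–
Sullivan 1975 §5; Griffiths–Schmid 1975 §4), which is the statement the tree's `∂∂̄` road
(`Literature.Algebra.Homology.DDbarCechSystem.exists_zigzag`, `Literature.NumberTheory.Transcendental.ddbar_of_exact`) proves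
first; the general Prop. 8.2.7 (singular `Z`, arbitrary family) is then not needed by this route.

Main results (all theorems; no definitions, no named facts; the modification hypothesis is spelled
inline each time):

* `mem_iSup_map_of_restrictCompl_eq_zero_of_pullback827` — Deligne descent for ONE family from
  Prop. 8.2.7 for that family (Cor. 8.2.8 per family + Voisin's lift, both theorems);
* `mem_algebraicClasses_of_restrictCompl_eq_zero_of_pullback827` — plus the Hodge conjecture in
  codimension `p − 1` on the members: the class is algebraic;
* `mem_algebraicClasses_of_modification827` — the same through a birational `π : X' ⟶ X`;
* `divisorInduction_of_modification827` — route decl `DivisorInduction` from the modification data;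
* `middleDivisorSupportSuffices_of_modification827` — the item from the modification data and
  `PencilReduction`;
* `modification827_of_deligne827` — sanity: the modification data are implied by the old leaf
  (take `X' = X`, `π = 𝟙`, the padded resolutions of the components), so the new recipe is at
  least as strong as `middleDivisorSupportSuffices_of_twoLeaves`; composed:
  `divisorInduction_of_deligne827` (route decl `DivisorInduction` from Prop. 8.2.7 alone).

## References

* [DeligneHodgeIII1974] P. Deligne, Théorie de Hodge III, Publ. Math. IHÉS 44 (1974), Prop. 8.2.7,
  Cor. 8.2.8.
* [Voisin2025] C. Voisin, Hodge and generalized Hodge conjectures, coniveau and algebraic cycles,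
  J. Open Math. Probl. 1 (2025), Cor. 2.12, Thm. 4.4.
* [DeligneGriffithsMorganSullivan1975] P. Deligne, P. Griffiths, J. Morgan, D. Sullivan, Real
  homotopy theory of Kähler manifolds, Invent. Math. 29 (1975), §5–§6.
* [Kollar2007] J. Kollár, Lectures on Resolution of Singularities (2007), Thm. 3.21.
* [Fulton1998] W. Fulton, Intersection Theory (1998), Lemma 19.1.2.
* [Thomas2005Nodes] R. Thomas, Nodes and the Hodge conjecture, J. Algebraic Geom. 14 (2005), §2.
-/

-- `Summit.HodgeConjecture.HodgeConjecture.Theorems` is the mandated namespace (single-conjunct summit: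
-- Sub = Summit), which `linter.dupNamespace` flags; off tree-wide in the lakefile, restated here so
-- stand-alone elaboration is warning-free too.
set_option linter.dupNamespace false

noncomputable section

open CategoryTheory AlgebraicGeometry
open Literature.AlgebraicTopology.SingularHomology
open Literature.AlgebraicGeometry.Motives Literature.AlgebraicGeometry.HodgeTheory
open Summit.HodgeConjecture.HodgeConjecture.Theses.LimitExtension

namespace Summit.HodgeConjecture.HodgeConjecture.Theorems

/-! ### Deligne descent for one family, from Prop. 8.2.7 for that family -/

/-- **Deligne descent for ONE family from Prop. 8.2.7 for that family.** For `X` smooth projective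
of dimension `n`, a finite family `g j : Y j ⟶ X` from smooth projective `Y j` and a rational
`(q,q)`-class `c` dying off `⋃ j, g_j(Y j)`: IF every class of `X(ℂ)` killed by all `(g j)(ℂ)^*`
vanishes near `{P | pt P ∈ ⋃ j, g_j(Y j)}` (Prop. 8.2.7 in Čech form for this family), THEN `c` is
a `ℂ`-combination of Gysin images `(g j)_* b` of rational `(d,d)`-classes `b` on the `Y j`
(Cor. 8.2.8 for this family, `ker_restrictCompl_eq_iSup_range_complexGysin_of_pullback`, chained
with Voisin's lift, the theorem `Voisin2025_hodgeClass_lift_complexGysin_holds`).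
[cite: DeligneHodgeIII1974, Prop. 8.2.7 and Cor. 8.2.8] [cite: Voisin2025, Cor. 2.12] -/
theorem mem_iSup_map_of_restrictCompl_eq_zero_of_pullback827
    (μ : OrientationFamily) (hμ : μ.HasPoincareDuality) {n : ℕ} {X : SchemeOver ℂ}
    (hX : IsSmoothProjective n X) {ι : Type} [Finite ι] {m : ι → ℕ} {Y : ι → SchemeOver ℂ}
    (hY : ∀ j, IsSmoothProjective (m j) (Y j)) (g : ∀ j, Y j ⟶ X)
    (H : ∀ (q : ℕ) (x' : complexBetti X q), (∀ j, complexBetti.map (g j) q x' = 0) →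
      ∃ V : Set (ComplexPoints X), IsOpen V ∧
        {P | P.pt ∈ ⋃ j, Set.range (g j).left.base} ⊆ V ∧
        singularCohomology.map ℂ ℂ (subsetIncl V) q x' = 0)
    {q : ℕ} {c : complexBetti X (2 * q)} (hc : IsRationalClass c)
    (hc' : IsOfHodgeType n X (2 * q) q q c)
    (h0 : complexBetti.restrictCompl X (⋃ j, Set.range (g j).left.base) (2 * q) c = 0) :
    c ∈ ⨆ (j : ι) (d : ℕ) (hd : 2 * d + 2 * n = 2 * q + 2 * m j),
      (Submodule.span ℂ {b : complexBetti (Y j) (2 * d) |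
          IsRationalClass b ∧ IsOfHodgeType (m j) (Y j) (2 * d) d d b}).map
        (complexGysin μ (hY j) hX (g j) hd) := by
  refine Voisin2025_hodgeClass_lift_complexGysin_holds μ hμ hX hY g q hc hc' ?_
  rw [← ker_restrictCompl_eq_iSup_range_complexGysin_of_pullback μ hX hY g (2 * q)
    (fun q' x' _ hx' ↦ H q' x' hx')]
  exact h0

/-- **The divisor step for one family from Prop. 8.2.7 for that family**: on a smooth projective
`(n+1)`-fold `X`, a rational `(p,p)`-class (`1 ≤ p`) dying off `⋃ j, g_j(Y j)` for a finite family
of morphisms from smooth projective `n`-FOLDS `Y j` satisfying Prop. 8.2.7 in Čech form is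
algebraic, granted the Hodge conjecture in codimension `p − 1` on the `Y j` (the lifted classes have
degree `2p − 2` on `n`-folds; Gysin images of algebraic classes are algebraic,
`complexGysin_mem_algebraicClasses`). [cite: DeligneHodgeIII1974, Cor. 8.2.8]
[cite: Voisin2025, Cor. 2.12 and Thm. 4.4] [cite: Thomas2005Nodes, §2] -/
theorem mem_algebraicClasses_of_restrictCompl_eq_zero_of_pullback827
    {n : ℕ} {X : SchemeOver ℂ} (hX : IsSmoothProjective (n + 1) X)
    {ι : Type} [Finite ι] {Y : ι → SchemeOver ℂ}
    (hY : ∀ j, IsSmoothProjective n (Y j)) (g : ∀ j, Y j ⟶ X)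
    (H : ∀ (q : ℕ) (x' : complexBetti X q), (∀ j, complexBetti.map (g j) q x' = 0) →
      ∃ V : Set (ComplexPoints X), IsOpen V ∧
        {P | P.pt ∈ ⋃ j, Set.range (g j).left.base} ⊆ V ∧
        singularCohomology.map ℂ ℂ (subsetIncl V) q x' = 0)
    {p : ℕ} (hp : 1 ≤ p)
    (hHC : ∀ (j : ι) (b : complexBetti (Y j) (2 * (p - 1))), IsRationalClass b →
      IsOfHodgeType n (Y j) (2 * (p - 1)) (p - 1) (p - 1) b → b ∈ algebraicClasses (Y j) (p - 1))
    {c : complexBetti X (2 * p)} (hc : IsRationalClass c)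
    (hc' : IsOfHodgeType (n + 1) X (2 * p) p p c)
    (h0 : complexBetti.restrictCompl X (⋃ j, Set.range (g j).left.base) (2 * p) c = 0) :
    c ∈ algebraicClasses X p := by
  classical
  -- the complex orientations and their Poincaré duality (a theorem of the tree)
  let μ : OrientationFamily := fun _ _ h ↦ Classical.choice (ComplexPoints.isOrientableOver ℂ h)
  have hμ : μ.HasPoincareDuality := μ.hasPoincareDuality
  have hmem := mem_iSup_map_of_restrictCompl_eq_zero_of_pullback827 μ hμ hX (m := fun _ ↦ n)
    hY g H hc hc' h0
  refine SetLike.le_def.mp (iSup_le fun j ↦ iSup_le fun d ↦ iSup_le fun hd ↦ ?_) hmem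
  rw [Submodule.map_le_iff_le_comap, Submodule.span_le]
  rintro b ⟨hb, hb'⟩
  rw [SetLike.mem_coe, Submodule.mem_comap]
  obtain rfl : d = p - 1 := by omega
  exact complexGysin_mem_algebraicClasses (gysinMap_restrictCompl_eq_zero_of_field ℂ) μ hμ (hY j) hX
    (g j) (by omega) hd (hHC j b hb hb')

/-! ### Through a modification -/

/-- **The divisor step through a modification.** Let `π : X' ⟶ X` be a birational morphism of
smooth projective `(n+1)`-folds, `e i : E i ⟶ X'` a finite family of morphisms from smooth
projective `n`-folds whose images cover `π⁻¹(Z)` and which satisfies Prop. 8.2.7 in Čech form on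
`X'`, and assume the Hodge conjecture in codimension `p − 1` on the `E i`. Then every rational
`(p,p)`-class `c` of `X` dying off `Z` is algebraic: `π^* c` dies off `⋃ i, e_i(E i)`
(`complexBetti.restrictCompl_map_eq_zero`, `complexBetti.restrictCompl_eq_zero_of_subset`), is
rational of type `(p,p)` (`IsRationalClass.map`, `IsOfHodgeType.map_of_isSmoothProjective`), hence
algebraic on `X'` by the previous theorem, and algebraicity descends along the degree-one `π`
(`exists_hasDegree_one_of_isBirational`, `mem_algebraicClasses_of_map_mem_of_hasDegree`).
[cite: DeligneHodgeIII1974, Cor. 8.2.8] [cite: Fulton1998, Lemma 19.1.2] [cite: Kollar2007, Thm. 3.21] -/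
theorem mem_algebraicClasses_of_modification827
    {n : ℕ} {X X' : SchemeOver ℂ} (hX : IsSmoothProjective (n + 1) X)
    (hX' : IsSmoothProjective (n + 1) X') (π : X' ⟶ X)
    (hπ : Literature.AlgebraicGeometry.Resolution.IsBirational π.left)
    {ι : Type} [Finite ι] {E : ι → SchemeOver ℂ} (hE : ∀ i, IsSmoothProjective n (E i))
    (e : ∀ i, E i ⟶ X')
    (H : ∀ (q : ℕ) (x' : complexBetti X' q), (∀ i, complexBetti.map (e i) q x' = 0) →
      ∃ V : Set (ComplexPoints X'), IsOpen V ∧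
        {P | P.pt ∈ ⋃ i, Set.range (e i).left.base} ⊆ V ∧
        singularCohomology.map ℂ ℂ (subsetIncl V) q x' = 0)
    {Z : Set X.left} (hZ : π.left.base ⁻¹' Z ⊆ ⋃ i, Set.range (e i).left.base)
    {p : ℕ} (hp : 1 ≤ p)
    (hHC : ∀ (i : ι) (b : complexBetti (E i) (2 * (p - 1))), IsRationalClass b →
      IsOfHodgeType n (E i) (2 * (p - 1)) (p - 1) (p - 1) b → b ∈ algebraicClasses (E i) (p - 1))
    {c : complexBetti X (2 * p)} (hc : IsRationalClass c)
    (hc' : IsOfHodgeType (n + 1) X (2 * p) p p c)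
    (h0 : complexBetti.restrictCompl X Z (2 * p) c = 0) :
    c ∈ algebraicClasses X p := by
  have h1 : complexBetti.restrictCompl X' (⋃ i, Set.range (e i).left.base) (2 * p)
      (complexBetti.map π (2 * p) c) = 0 :=
    complexBetti.restrictCompl_eq_zero_of_subset hZ (complexBetti.restrictCompl_map_eq_zero π h0)
  have halg' : complexBetti.map π (2 * p) c ∈ algebraicClasses X' p :=
    mem_algebraicClasses_of_restrictCompl_eq_zero_of_pullback827 hX' hE e H hp hHC
      (hc.map (AlgPoints.mapContinuous (L := ℂ) π)) (hc'.map_of_isSmoothProjective hX' hX π) h1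
  obtain ⟨μ, ν, hμν⟩ := exists_hasDegree_one_of_isBirational hX' hX π hπ
  exact mem_algebraicClasses_of_map_mem_of_hasDegree hX' hX π μ ν one_ne_zero hμν halg'

/-! ### The route decls from the modification data -/

/-- **`DivisorInduction` (stmt-HodgeConjecture-1082, route decl) from modification data**: if every
closed `Z` of codimension `≥ 1` in a smooth projective `(n+1)`-fold `X` is dominated, through some
birational `π : X' ⟶ X` of smooth projective `(n+1)`-folds, by a finite family of morphisms from
smooth projective `n`-folds into `X'` covering `π⁻¹(Z)` and satisfying Prop. 8.2.7 in Čech form on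
`X'` (supplied e.g. by the tree's proved log resolution `Resolution.exists_logResolution_of_isClosed`
and the principle of two types for the components of an SNC divisor), then rational `(p,p)`-classes
supported on a divisor are algebraic granted the Hodge conjecture one codimension down
(`exists_isClosed_of_mem_supportedClasses` + `mem_algebraicClasses_of_modification827`).
[cite: DeligneHodgeIII1974, Cor. 8.2.8] [cite: Kollar2007, Thm. 3.21]
[cite: DeligneGriffithsMorganSullivan1975, §5–§6] [cite: Thomas2005Nodes, §2] -/
theorem divisorInduction_of_modification827
    (hMod : ∀ ⦃n : ℕ⦄ ⦃X : SchemeOver ℂ⦄, IsSmoothProjective (n + 1) X → ∀ ⦃Z : Set X.left⦄,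
      IsClosed Z → (∀ z ∈ Z, (1 : ℕ∞) ≤ Order.coheight z) →
      ∃ (X' : SchemeOver ℂ) (_ : IsSmoothProjective (n + 1) X') (π : X' ⟶ X)
        (_ : Literature.AlgebraicGeometry.Resolution.IsBirational π.left)
        (ι : Type) (_ : Finite ι) (E : ι → SchemeOver ℂ) (_ : ∀ i, IsSmoothProjective n (E i))
        (e : ∀ i, E i ⟶ X'),
        π.left.base ⁻¹' Z ⊆ ⋃ i, Set.range (e i).left.base ∧
        ∀ (q : ℕ) (x' : complexBetti X' q), (∀ i, complexBetti.map (e i) q x' = 0) →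
          ∃ V : Set (ComplexPoints X'), IsOpen V ∧
            {P | P.pt ∈ ⋃ i, Set.range (e i).left.base} ⊆ V ∧
            singularCohomology.map ℂ ℂ (subsetIncl V) q x' = 0) :
    DivisorInduction := by
  intro n p hp hHC X hX c hc hc' hsupp
  obtain ⟨Z, hZc, hZ1, hcZ⟩ := exists_isClosed_of_mem_supportedClasses hsupp
  obtain ⟨X', hX', π, hπ, ι, hι, E, hE, e, hZ, H⟩ := hMod hX hZc hZ1
  haveI := hι
  exact mem_algebraicClasses_of_modification827 hX hX' π hπ hE e H hZ hp
    (fun i b hb hb' ↦ hHC (hE i) b hb hb') hc hc' hcZ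

/-- **`MiddleDivisorSupportSuffices` (stmt-HodgeConjecture-10865) from the modification data and the
pencil crux** (`PencilReduction`, stmt-HodgeConjecture-1083): the planner's assembly
`middleDivisorSupportSuffices_of_nodalSupport` fed with `divisorInduction_of_modification827`. With
this recipe the only Hodge-theoretic input of the item outside the pencil step is Prop. 8.2.7 for
the exceptional family of a modification (e.g. the smooth components of an SNC divisor), not for an
arbitrary singular `Z`. [cite: Thomas2005Nodes, Prop. 2 (proof)]
[cite: DecataldoMigliorini2009, §4 Prop. 4.5] [cite: DeligneHodgeIII1974, Cor. 8.2.8] -/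
theorem middleDivisorSupportSuffices_of_modification827
    (hMod : ∀ ⦃n : ℕ⦄ ⦃X : SchemeOver ℂ⦄, IsSmoothProjective (n + 1) X → ∀ ⦃Z : Set X.left⦄,
      IsClosed Z → (∀ z ∈ Z, (1 : ℕ∞) ≤ Order.coheight z) →
      ∃ (X' : SchemeOver ℂ) (_ : IsSmoothProjective (n + 1) X') (π : X' ⟶ X)
        (_ : Literature.AlgebraicGeometry.Resolution.IsBirational π.left)
        (ι : Type) (_ : Finite ι) (E : ι → SchemeOver ℂ) (_ : ∀ i, IsSmoothProjective n (E i))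
        (e : ∀ i, E i ⟶ X'),
        π.left.base ⁻¹' Z ⊆ ⋃ i, Set.range (e i).left.base ∧
        ∀ (q : ℕ) (x' : complexBetti X' q), (∀ i, complexBetti.map (e i) q x' = 0) →
          ∃ V : Set (ComplexPoints X'), IsOpen V ∧
            {P | P.pt ∈ ⋃ i, Set.range (e i).left.base} ⊆ V ∧
            singularCohomology.map ℂ ℂ (subsetIncl V) q x' = 0)
    (hPen : PencilReduction) : MiddleDivisorSupportSuffices :=
  middleDivisorSupportSuffices_of_nodalSupport (divisorInduction_of_modification827 hMod) hPen

/-- **Sanity: the modification data are implied by the old leaf.** Deligne's Prop. 8.2.7 for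
arbitrary families (`Deligne1974_ker_pullback_eq_ker_pullback_resolution`) yields the modification
data with `X' = X`, `π = 𝟙 X` and the padded resolutions of the components of `Z`
(`exists_equidim_family_iUnion_range_eq`, projective Hironaka — a theorem of the tree); so the
recipe `middleDivisorSupportSuffices_of_modification827` asks for no more than
`middleDivisorSupportSuffices_of_twoLeaves`. [cite: DeligneHodgeIII1974, Prop. 8.2.7]
[cite: Kollar2007, Thm. 3.27] -/
theorem modification827_of_deligne827 (h827 : Deligne1974_ker_pullback_eq_ker_pullback_resolution) :
    ∀ ⦃n : ℕ⦄ ⦃X : SchemeOver ℂ⦄, IsSmoothProjective (n + 1) X → ∀ ⦃Z : Set X.left⦄,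
      IsClosed Z → (∀ z ∈ Z, (1 : ℕ∞) ≤ Order.coheight z) →
      ∃ (X' : SchemeOver ℂ) (_ : IsSmoothProjective (n + 1) X') (π : X' ⟶ X)
        (_ : Literature.AlgebraicGeometry.Resolution.IsBirational π.left)
        (ι : Type) (_ : Finite ι) (E : ι → SchemeOver ℂ) (_ : ∀ i, IsSmoothProjective n (E i))
        (e : ∀ i, E i ⟶ X'),
        π.left.base ⁻¹' Z ⊆ ⋃ i, Set.range (e i).left.base ∧
        ∀ (q : ℕ) (x' : complexBetti X' q), (∀ i, complexBetti.map (e i) q x' = 0) →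
          ∃ V : Set (ComplexPoints X'), IsOpen V ∧
            {P | P.pt ∈ ⋃ i, Set.range (e i).left.base} ⊆ V ∧
            singularCohomology.map ℂ ℂ (subsetIncl V) q x' = 0 := by
  intro n X hX Z hZc hZ1
  obtain ⟨ι, hι, Y, hY, g, hZg⟩ := exists_equidim_family_iUnion_range_eq hX hZc hZ1
  haveI := hι
  have hid : Literature.AlgebraicGeometry.Resolution.IsBirational (𝟙 X : X ⟶ X).left := by
    rw [Over.id_left]
    exact ⟨⊤, by simp [dense_univ], by simp [dense_univ], inferInstance⟩
  refine ⟨X, hX, 𝟙 X, hid, ι, hι, Y, hY, g, ?_, fun q x' hx' ↦ h827 hX hY g q x' hx'⟩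
  intro z hz
  rw [hZg]
  simpa only [Over.id_left, Scheme.Hom.id_base, Set.mem_preimage, TopCat.id_app] using hz

/-- **`DivisorInduction` (stmt-HodgeConjecture-1082, route decl) from Deligne's Prop. 8.2.7 alone**,
through the modification recipe (`modification827_of_deligne827` + `divisorInduction_of_modification827`;
Voisin's lift and projective Hironaka are theorems of the tree). CONDITIONAL on the named fact
`h827` only; records that the modification recipe asks for no more than the old leaf.
[cite: DeligneHodgeIII1974, Prop. 8.2.7 and Cor. 8.2.8] [cite: Voisin2025, Cor. 2.12] -/
theorem divisorInduction_of_deligne827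
    (h827 : Deligne1974_ker_pullback_eq_ker_pullback_resolution) : DivisorInduction :=
  divisorInduction_of_modification827 (modification827_of_deligne827 h827)

end Summit.HodgeConjecture.HodgeConjecture.Theorems

end
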